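/-
Copyright (c) 2026 the pub-hodgecm-mathlib formalisation cell (harness21).  Prover seat hodgecm-mathlib-K2E5-p15 (g3), HCML Track B «K2-LIT»,
h413 = `stmt-HodgeConjecture-24833`, (SC-an) line (lead K2E3-p14 (g3)), road «HC-14-ell», file E4 «THE `𝔲(2)` BASE CASE» — STRUCTURE FILE C
(dealer K2E3-plan (g2) deal (D45); lead RULINGS #7 (R7-1)∕(R7-2)).  2026-09-04.
-/
import Summits.HodgeConjecture.HodgeConjecture.Theorems.K2E3HC14EllU11Elliptic      -- FILE A′ (this seat): `apply_one_zero_ne_zero_…`, `charpoly_eval_line_ne_zero`; brings FILE A (orbit formulas) and ★ `normAbs`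
import Literature.NumberTheory.Automorphic.HyperspecialUnitaryCompactOpen          -- ★ `continuous_of_forall_v_eq`
import Literature.NumberTheory.Automorphic.ValuedFieldValuativeRelBridge           -- ★ `v_le_iff_valuation_le`
import Summits.HodgeConjecture.HodgeConjecture.Theorems.K2E3SplitTorusTwistModuleBound   -- ★ (K2E3-p20): `normAbs_map_eq` (`|σ x|_K = |x|_K`)
import HarnessLib

/-!
# h413 ∕ Track B «K2-LIT», road «HC-14-ell», file E4 — STRUCTURE FILE C: THE FIBRES OF THE ELLIPTIC ORBIT IN IWASAWA COORDINATES
# (the completed square `|2z − tr Y|² ≤ max(|disc Y|, |4|·|χ_Y(z)|)`; the positive lower bound `c₀ ≤ |χ_Y(y₁₁ + w y₁₀)|` on `K⁻`; the fibre over `t = diag(d)` of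
# `{(t,n) : |b·((tn)⁻¹Y(tn))₀₁| ≤ R}` is EMPTY unless `c₀ ≤ (R∕|b|)·|d₀|²·|y₁₀|` and has coordinate diameter `≤ L·|b|^{−1∕2}·|d₀|⁻¹`)

Cell `pub/hodgecm-mathlib`, crux H413 = `stmt-HodgeConjecture-24833` (lane `--supports … --as helper`, count-neutral); seat K2E5-p15 (g3); dealer K2E3-plan (g2)
deal (D45); (SC-an) line lead K2E3-p14 (g3) (RULINGS #7).  THEOREMS ONLY (no `def`, no `instance`, no `notation`, no named-fact hypothesis, no `sorry`); never
imports `Cruxes/…/Lines`.  Fifth structure file behind §2 (E4-iso) of `Theorems/K2E3HC14EllBaseCaseU2.lean` (HC Thm 13 for the compact Cartans of `𝔲(1,1)`): the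
POINTWISE (valuation-theoretic) half of the volume estimate; the measure-theoretic half is FILE D.

THE MATHEMATICS ([HarishChandra1970, Part V §3 Thm. 13]).  `K` non-archimedean local with `2 ≠ 0`, `σ` a valuation-preserving involution, `J = Φ₂`, `Y ∈ 𝔲(σ,Φ₂)` regular
elliptic, `τ = tr Y`, `D = disc χ_Y`, `χ_Y(z) = z² − τz + det Y`.  §1 `(2z − τ)² = 4χ_Y(z) + D`, so **`|2z − τ|² ≤ max(|D|, |4|·|χ_Y(z)|)`** (ultrametric).  §2 On the closed
line `K⁻` the continuous function `w ↦ |χ_Y(y₁₁ + w·y₁₀)|` has no zero (FILE A′ `charpoly_eval_line_ne_zero`) and its sublevel set `{≤ 1}` is bounded (§1), hence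
**`∃ c₀ > 0, c₀ ≤ |χ_Y(y₁₁ + w·y₁₀)|` for all `w ∈ K⁻`**.  §3 For `t = diag(d₀, σ(d₀)⁻¹)`, `n, n' ∈ N₂` with coordinates `x, x'`, and `Z = (tn)⁻¹Y(tn)`: FILE A gives
`Z₁₀ = ν y₁₀`, `Z₁₁ = y₁₁ + νx·y₁₀`, `Z₀₁Z₁₀ = −χ_Y(Z₁₁)` (`ν = d₀σ(d₀)`, `|ν| = |d₀|²`); if `|b·Z₀₁| ≤ R` then `c₀ ≤ |χ_Y(Z₁₁)| = |Z₀₁|·|d₀|²·|y₁₀| ≤ (R∕|b|)·|d₀|²·|y₁₀|`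
(**threshold**), and `|2Z₁₁ − τ|² ≤ C₁·(R∕|b|)·|d₀|²·|y₁₀|` with `C₁ = max(|D|∕c₀, |4|)`; subtracting the same for `n'`, `2ν y₁₀ (x − x') = (2Z₁₁ − τ) − (2Z'₁₁ − τ)` gives the
**diameter bound** `|x − x'| ≤ L·(√|b|)⁻¹·|d₀|⁻¹`, `L = √(C₁ R |y₁₀|)∕(|2||y₁₀|)`.

## References
* [HarishChandra1970] Harish-Chandra (notes by G. van Dijk), *Harmonic Analysis on Reductive p-adic Groups*, LNM 162 (1970), Part V §3 Thm. 13 p. 51.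
* [Rogawski1990] J. D. Rogawski, *Automorphic Representations of Unitary Groups in Three Variables*, Ann. of Math. Stud. 123 (1990), §1.10 p. 9; §3.6 pp. 28–31.
* [WeilBNT1967] A. Weil, *Basic Number Theory* (1967), Ch. I §2, Ch. II §1 (ultrametric balls, local compactness).
-/

set_option autoImplicit false
set_option linter.dupNamespace false  -- the mandated namespace repeats the single-problem summit's segment (`HodgeConjecture.HodgeConjecture`)

noncomputable section

open Matrix Set Filter Topology ValuativeRel
open scoped MatrixGroups NNReal WithZero
open Literature.NumberTheory.Automorphic Literature.NumberTheory.Automorphic.UnitaryGroup Literature.NumberTheory.Automorphic.UnitaryGroup.HeisRing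
open Literature.NumberTheory.Automorphic.UnitaryGroup.LineRing Literature.NumberTheory.Automorphic.HermitianLattice
open Literature.NumberTheory.GaloisRepresentations Literature.NumberTheory.GaloisRepresentations.IsNonarchimedeanLocalField
open Summit.HodgeConjecture.HodgeConjecture.Cruxes.H413.K2E3HC14EllU11Orbit Summit.HodgeConjecture.HodgeConjecture.Cruxes.H413.K2E3HC14EllU11Elliptic
open Summit.HodgeConjecture.HodgeConjecture.Cruxes.H413.K2E3SplitTorusTwistModuleBound (normAbs_map_eq)

namespace Summit.HodgeConjecture.HodgeConjecture.Cruxes.H413.K2E3HC14EllU11Fibre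

/-! ## §1 The completed square -/

section Square

variable {K : Type*} [Field K] [ValuativeRel K] [TopologicalSpace K] [IsNonarchimedeanLocalField K]

/-- **`|2z − tr Y|² ≤ max(|disc Y|, |4|·|χ_Y(z)|)`** for every `z`, with `χ_Y(z) = z² − (tr Y) z + det Y`: `(2z − tr Y)² = 4χ_Y(z) + disc Y` (Mathlib `Matrix.discr_fin_two`) and `|·|_K`
is ultrametric (★ `normAbs_add_le_max`). [cite: HarishChandra1970, Part V §3 Thm. 13 p. 51] [cite: WeilBNT1967, Ch. I §2] -/
theorem normAbs_two_mul_sub_trace_sq_le (Y : Matrix (Fin 2) (Fin 2) K) (z : K) :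
    normAbs K (2 * z - Matrix.trace Y) ^ 2 ≤ max (normAbs K (Matrix.charpoly Y).discr) (normAbs K 4 * normAbs K (z ^ 2 - Matrix.trace Y * z + Y.det)) := by
  have hid : (2 * z - Matrix.trace Y) ^ 2 = (Matrix.charpoly Y).discr + 4 * (z ^ 2 - Matrix.trace Y * z + Y.det) := by
    have h := Matrix.discr_fin_two Y
    rw [Matrix.discr] at h
    rw [h]; ring
  rw [← map_pow, hid, ← map_mul]
  exact normAbs_add_le_max _ _

/-- A closed ball `{x : |x|_K ≤ W}` of the local field lies in a compact set (inside `{v ≤ v(a)}` for some `a` with `|a| ≥ W`, Mathlib `isCompact_closedBall`).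
[cite: WeilBNT1967, Ch. I §2] -/
theorem exists_isCompact_normAbs_le_subset (W : ℝ≥0) : ∃ C : Set K, IsCompact C ∧ {x : K | normAbs K x ≤ W} ⊆ C := by
  obtain ⟨ϖ, hϖ0, hϖ⟩ := exists_normAbs_eq_inv (F := K)
  have hq : 1 < (residueFieldCard K : ℝ≥0) := by exact_mod_cast one_lt_residueFieldCard K
  obtain ⟨k, hk⟩ := pow_unbounded_of_one_lt W hq
  refine ⟨{x : K | valuation K x ≤ valuation K (ϖ⁻¹ ^ k)}, IsNonarchimedeanLocalField.isCompact_closedBall K _, fun x hx => ?_⟩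
  simp only [Set.mem_setOf_eq] at hx ⊢
  rw [← normAbs_le_normAbs_iff, map_pow, map_inv₀, hϖ, inv_inv]
  exact hx.trans hk.le

end Square

/-! ## §2 A positive lower bound for `|χ_Y|` on the line `y₁₁ + K⁻·y₁₀` -/

section LowerBound

variable {K : Type*} [Field K] [Valued K ℤᵐ⁰] [ValuativeRel K] [(Valued.v : Valuation K ℤᵐ⁰).Compatible] [IsNonarchimedeanLocalField K]
  (σ : K →+* K) (hσ : ∀ x, σ (σ x) = x) (hσv : ∀ x, Valued.v (σ x) = Valued.v x)
  {J : Matrix (Fin 2) (Fin 2) K} (hJ : J = (StdForm.antidiagonal 2).over K)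

omit [(Valued.v : Valuation K ℤᵐ⁰).Compatible] in
include hσ hσv hJ in
/-- **`∃ c₀ > 0, c₀ ≤ |χ_Y(y₁₁ + w·y₁₀)|` FOR ALL `w ∈ K⁻`** when `Y ∈ 𝔲(σ, Φ₂)(K)` is regular elliptic and `2 ≠ 0`: the continuous function has no zero on the closed line
`K⁻` (FILE A′ `charpoly_eval_line_ne_zero`), and `{w : |χ_Y(y₁₁ + w y₁₀)| ≤ 1}` is bounded (§1: `|2(y₁₁ + w y₁₀) − τ|² ≤ max(|D|, |4|)`, `2y₁₀ ≠ 0`), so the infimum over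
`K⁻ ∩ {≤ 1}` is a minimum over a compact set. [cite: HarishChandra1970, Part V §3 Thm. 13 p. 51] [cite: WeilBNT1967, Ch. I §2] -/
theorem exists_pos_le_normAbs_charpoly_line (h2 : (2 : K) ≠ 0) {Y : Matrix (Fin 2) (Fin 2) K} (hY : (Y.map σ)ᵀ * J + J * Y = 0)
    (hYreg : (Matrix.charpoly Y).discr ≠ 0)
    (hYell : IsCompact {g : ↥(unitaryGroupOfForm σ J) |
      ((g : GL (Fin 2) K) : Matrix (Fin 2) (Fin 2) K) * Y * (((g : GL (Fin 2) K)⁻¹ : GL (Fin 2) K) : Matrix (Fin 2) (Fin 2) K) = Y}) :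
    ∃ c₀ : ℝ≥0, 0 < c₀ ∧ ∀ w : K, σ w = -w → c₀ ≤ normAbs K ((Y 1 1 + w * Y 1 0) ^ 2 - Matrix.trace Y * (Y 1 1 + w * Y 1 0) + Y.det) := by
  haveI : T2Space K := (isLocalField K).toT2Space
  have hσc : Continuous σ := continuous_of_forall_v_eq hσv
  have h10 : Y 1 0 ≠ 0 := apply_one_zero_ne_zero_of_isCompact_centralizer σ hσ hJ hY hYreg hYell
  set F : K → ℝ≥0 := fun w => normAbs K ((Y 1 1 + w * Y 1 0) ^ 2 - Matrix.trace Y * (Y 1 1 + w * Y 1 0) + Y.det) with hF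
  have hFc : Continuous F := LocalFieldHaar.continuous_normAbs.comp (by fun_prop)
  -- `{F ≤ 1}` is bounded
  set M₀ : ℝ≥0 := max (NNReal.sqrt (max (normAbs K (Matrix.charpoly Y).discr) (normAbs K 4))) (normAbs K (2 * Y 1 1 - Matrix.trace Y)) with hM₀
  have h2y : 0 < normAbs K (2 * Y 1 0) := pos_iff_ne_zero.2 ((map_ne_zero _).2 (mul_ne_zero h2 h10))
  have hbound : ∀ w : K, F w ≤ 1 → normAbs K w ≤ M₀ / normAbs K (2 * Y 1 0) := by
    intro w hw
    rw [le_div_iff₀ h2y, ← map_mul]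
    have hsq := normAbs_two_mul_sub_trace_sq_le Y (Y 1 1 + w * Y 1 0)
    have h1 : normAbs K (2 * (Y 1 1 + w * Y 1 0) - Matrix.trace Y) ^ 2 ≤ max (normAbs K (Matrix.charpoly Y).discr) (normAbs K 4) := by
      refine hsq.trans (max_le_max le_rfl ?_)
      calc normAbs K 4 * F w ≤ normAbs K 4 * 1 := mul_le_mul' le_rfl hw
        _ = normAbs K 4 := mul_one _
    have h3 : normAbs K (2 * (Y 1 1 + w * Y 1 0) - Matrix.trace Y) ≤ NNReal.sqrt (max (normAbs K (Matrix.charpoly Y).discr) (normAbs K 4)) :=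
      NNReal.le_sqrt_iff_sq_le.2 h1
    have hid : w * (2 * Y 1 0) = (2 * (Y 1 1 + w * Y 1 0) - Matrix.trace Y) + -(2 * Y 1 1 - Matrix.trace Y) := by ring
    rw [hid]
    refine (normAbs_add_le_max _ _).trans ?_
    rw [normAbs_neg]
    exact max_le_max h3 le_rfl
  -- the compact set `A = C ∩ K⁻ ∩ {F ≤ 1}`
  obtain ⟨C, hC, hsubC⟩ := exists_isCompact_normAbs_le_subset (K := K) (M₀ / normAbs K (2 * Y 1 0))
  set A : Set K := C ∩ ({w : K | σ w = -w} ∩ {w : K | F w ≤ (1 : ℝ≥0)}) with hA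
  have hF1 : IsClosed {w : K | F w ≤ (1 : ℝ≥0)} := isClosed_le hFc continuous_const
  have hAc : IsCompact A := hC.inter_right ((isClosed_eq hσc continuous_neg).inter hF1)
  have hmemA : ∀ w : K, σ w = -w → F w ≤ 1 → w ∈ A := fun w hw hle => ⟨hsubC (hbound w hle), hw, hle⟩
  have hAskew : ∀ w ∈ A, σ w = -w := fun w hw => hw.2.1
  by_cases hne : A.Nonempty
  · obtain ⟨w₀, hw₀A, hmin⟩ := hAc.exists_isMinOn hne hFc.continuousOn
    have hpos : 0 < F w₀ :=
      pos_iff_ne_zero.2 ((map_ne_zero _).2 (charpoly_eval_line_ne_zero σ hσ hJ hY hYreg hYell (hAskew w₀ hw₀A)))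
    refine ⟨min (F w₀) 1, lt_min hpos one_pos, fun w hw => ?_⟩
    by_cases hle : F w ≤ 1
    · exact (min_le_left _ _).trans (hmin (hmemA w hw hle))
    · exact (min_le_right _ _).trans (not_le.1 hle).le
  · refine ⟨1, one_pos, fun w hw => ?_⟩
    by_contra hlt
    exact hne ⟨w, hmemA w hw (not_le.1 hlt).le⟩

end LowerBound

/-! ## §3 The fibres over the torus: threshold and diameter -/

section Fibre

variable {K : Type*} [Field K] [Valued K ℤᵐ⁰] [ValuativeRel K] [(Valued.v : Valuation K ℤᵐ⁰).Compatible] [IsNonarchimedeanLocalField K]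
  (σ : K →+* K) (hσ : ∀ x, σ (σ x) = x) (hσv : ∀ x, Valued.v (σ x) = Valued.v x)
  {J : Matrix (Fin 2) (Fin 2) K} (hJ : J = (StdForm.antidiagonal 2).over K)

include hσ hσv hJ in
/-- **THE FIBRE OVER `t = diag(d₀, σ(d₀)⁻¹)`: THRESHOLD AND DIAMETER.**  Let `Y ∈ M₂(K)`, let `c₀ > 0` bound `|χ_Y|` below on the line `y₁₁ + K⁻·y₁₀`
(§2), `b ≠ 0`, `R ≥ 0`, and let `n, n' ∈ N₂` (coordinates `x, x'`) be such that `Z = (tn)⁻¹Y(tn)` and `Z' = (tn')⁻¹Y(tn')` both satisfy `|b·Z₀₁| ≤ R`.  Then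
(THRESHOLD) `c₀ ≤ (R∕|b|)·|d₀|²·|y₁₀|`, and (DIAMETER) `|x − x'|·(|2|·|d₀|·|y₁₀|)·√|b| ≤ √(max(|D|∕c₀, |4|)·R·|y₁₀|)` — from FILE A (`Z₁₀ = ν y₁₀`, `Z₁₁ = y₁₁ + νx y₁₀`,
`Z₀₁Z₁₀ = −χ_Y(Z₁₁)`, `|ν| = |d₀|²`) and §1. [cite: HarishChandra1970, Part V §3 Thm. 13 p. 51] -/
theorem fibre_threshold_and_diameter (Y : Matrix (Fin 2) (Fin 2) K)
    {c₀ : ℝ≥0} (hc₀ : 0 < c₀) (hc₀le : ∀ w : K, σ w = -w → c₀ ≤ normAbs K ((Y 1 1 + w * Y 1 0) ^ 2 - Matrix.trace Y * (Y 1 1 + w * Y 1 0) + Y.det))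
    {t : ↥(unitaryGroupOfForm σ J)} (ht : t ∈ torusU σ J) {d : Fin 2 → Kˣ} (hd : glDiagonal 2 K d = (t : GL (Fin 2) K))
    (n n' : ↥(unipotentU σ J)) {b : K} (hb : b ≠ 0) {R : ℝ≥0}
    {g g' : GL (Fin 2) K} (hg : g = (t : GL (Fin 2) K) * ((n : ↥(unitaryGroupOfForm σ J)) : GL (Fin 2) K))
    (hg' : g' = (t : GL (Fin 2) K) * ((n' : ↥(unitaryGroupOfForm σ J)) : GL (Fin 2) K))
    (hn : normAbs K (b * (((g⁻¹ : GL (Fin 2) K) : Matrix (Fin 2) (Fin 2) K) * Y * (g : Matrix (Fin 2) (Fin 2) K)) 0 1) ≤ R)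
    (hn' : normAbs K (b * (((g'⁻¹ : GL (Fin 2) K) : Matrix (Fin 2) (Fin 2) K) * Y * (g' : Matrix (Fin 2) (Fin 2) K)) 0 1) ≤ R) :
    c₀ ≤ R / normAbs K b * normAbs K (d 0 : K) ^ 2 * normAbs K (Y 1 0) ∧
      normAbs K ((((n : ↥(unitaryGroupOfForm σ J)) : GL (Fin 2) K) : Matrix (Fin 2) (Fin 2) K) 0 1 -
            (((n' : ↥(unitaryGroupOfForm σ J)) : GL (Fin 2) K) : Matrix (Fin 2) (Fin 2) K) 0 1) *
          (normAbs K 2 * normAbs K (d 0 : K) * normAbs K (Y 1 0)) * NNReal.sqrt (normAbs K b) ≤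
        NNReal.sqrt (max (normAbs K (Matrix.charpoly Y).discr / c₀) (normAbs K 4) * R * normAbs K (Y 1 0)) := by
  -- notation and the orbit formulas of FILE A
  set x : K := (((n : ↥(unitaryGroupOfForm σ J)) : GL (Fin 2) K) : Matrix (Fin 2) (Fin 2) K) 0 1 with hx
  set x' : K := (((n' : ↥(unitaryGroupOfForm σ J)) : GL (Fin 2) K) : Matrix (Fin 2) (Fin 2) K) 0 1 with hx'
  set Z : Matrix (Fin 2) (Fin 2) K := ((g⁻¹ : GL (Fin 2) K) : Matrix (Fin 2) (Fin 2) K) * Y * (g : Matrix (Fin 2) (Fin 2) K) with hZ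
  set Z' : Matrix (Fin 2) (Fin 2) K := ((g'⁻¹ : GL (Fin 2) K) : Matrix (Fin 2) (Fin 2) K) * Y * (g' : Matrix (Fin 2) (Fin 2) K) with hZ'
  set ν : K := (d 0 : K) * σ (d 0 : K) with hν
  set β : ℝ≥0 := normAbs K b with hβ
  set φ : ℝ≥0 := normAbs K (d 0 : K) with hφ
  have hβ0 : 0 < β := pos_iff_ne_zero.2 ((map_ne_zero _).2 hb)
  have hφ0 : 0 < φ := pos_iff_ne_zero.2 ((map_ne_zero _).2 (d 0).ne_zero)
  have hνn : normAbs K ν = φ ^ 2 := by rw [hν, map_mul, normAbs_map_eq σ hσv, sq]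
  obtain ⟨hZ10, hZ11⟩ := conj_torus_unipotent_apply σ hJ ht hd n Y hg
  obtain ⟨-, hZ'11⟩ := conj_torus_unipotent_apply σ hJ ht hd n' Y hg'
  rw [← hZ, ← hν] at hZ10
  rw [← hZ, ← hν, ← hx] at hZ11
  rw [← hZ', ← hν, ← hx'] at hZ'11
  have hprod := conj_apply_zero_one_mul_apply_one_zero g Y
  have hprod' := conj_apply_zero_one_mul_apply_one_zero g' Y
  rw [← hZ] at hprod
  rw [← hZ'] at hprod'
  -- `|χ_Y(Z₁₁)| = |Z₀₁|·|ν|·|y₁₀| ≤ (R/β)·φ²·|y₁₀| =: P`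
  have hchi : ∀ {W : Matrix (Fin 2) (Fin 2) K}, W 0 1 * W 1 0 = -(W 1 1 ^ 2 - Matrix.trace Y * W 1 1 + Y.det) → W 1 0 = ν * Y 1 0 →
      normAbs K (W 1 1 ^ 2 - Matrix.trace Y * W 1 1 + Y.det) = normAbs K (W 0 1) * (φ ^ 2 * normAbs K (Y 1 0)) := by
    intro W hW hW10
    have : W 1 1 ^ 2 - Matrix.trace Y * W 1 1 + Y.det = -(W 0 1 * W 1 0) := by rw [hW]; ring
    rw [this, normAbs_neg, map_mul, hW10, map_mul, hνn]
  have hentry : ∀ {W : Matrix (Fin 2) (Fin 2) K}, normAbs K (b * W 0 1) ≤ R → normAbs K (W 0 1) ≤ R / β := by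
    intro W hW
    rw [le_div_iff₀ hβ0, mul_comm, hβ, ← map_mul]; exact hW
  have hP : ∀ {W : Matrix (Fin 2) (Fin 2) K}, W 0 1 * W 1 0 = -(W 1 1 ^ 2 - Matrix.trace Y * W 1 1 + Y.det) → W 1 0 = ν * Y 1 0 → normAbs K (b * W 0 1) ≤ R →
      normAbs K (W 1 1 ^ 2 - Matrix.trace Y * W 1 1 + Y.det) ≤ R / β * φ ^ 2 * normAbs K (Y 1 0) := by
    intro W hW hW10 hWb
    rw [hchi hW hW10, mul_assoc]
    exact mul_le_mul' (hentry hWb) le_rfl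
  -- threshold: `Z₁₁ = y₁₁ + (νx)·y₁₀` lies on the line, `νx ∈ K⁻`
  have hνσ : σ ν = ν := by rw [hν, map_mul, hσ, mul_comm]
  have hw : ∀ m : ↥(unipotentU σ J), σ (ν * (((m : ↥(unitaryGroupOfForm σ J)) : GL (Fin 2) K) : Matrix (Fin 2) (Fin 2) K) 0 1) =
      -(ν * (((m : ↥(unitaryGroupOfForm σ J)) : GL (Fin 2) K) : Matrix (Fin 2) (Fin 2) K) 0 1) := fun m => by
    rw [map_mul, hνσ, map_umat_zero_one_two σ hJ m, mul_neg]
  have hthr : c₀ ≤ R / β * φ ^ 2 * normAbs K (Y 1 0) := by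
    have h1 : c₀ ≤ normAbs K ((Y 1 1 + ν * x * Y 1 0) ^ 2 - Matrix.trace Y * (Y 1 1 + ν * x * Y 1 0) + Y.det) := hc₀le (ν * x) (hw n)
    rw [← hZ11] at h1
    exact h1.trans (hP hprod hZ10 hn)
  refine ⟨hthr, ?_⟩
  -- diameter: `|2Z₁₁ − τ|² ≤ C₁·P` for both fibre points
  set C₁ : ℝ≥0 := max (normAbs K (Matrix.charpoly Y).discr / c₀) (normAbs K 4) with hC₁
  set P : ℝ≥0 := R / β * φ ^ 2 * normAbs K (Y 1 0) with hPdef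
  have hsq : ∀ {W : Matrix (Fin 2) (Fin 2) K}, W 0 1 * W 1 0 = -(W 1 1 ^ 2 - Matrix.trace Y * W 1 1 + Y.det) → W 1 0 = ν * Y 1 0 → normAbs K (b * W 0 1) ≤ R →
      normAbs K (2 * W 1 1 - Matrix.trace Y) ≤ NNReal.sqrt (C₁ * P) := by
    intro W hW hW10 hWb
    refine NNReal.le_sqrt_iff_sq_le.2 ((normAbs_two_mul_sub_trace_sq_le Y (W 1 1)).trans (max_le ?_ ?_))
    · calc normAbs K (Matrix.charpoly Y).discr = normAbs K (Matrix.charpoly Y).discr / c₀ * c₀ := (div_mul_cancel₀ _ hc₀.ne').symm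
        _ ≤ normAbs K (Matrix.charpoly Y).discr / c₀ * P := mul_le_mul' le_rfl hthr
        _ ≤ C₁ * P := mul_le_mul' (le_max_left _ _) le_rfl
    · calc normAbs K 4 * normAbs K (W 1 1 ^ 2 - Matrix.trace Y * W 1 1 + Y.det) ≤ normAbs K 4 * P := mul_le_mul' le_rfl (hP hW hW10 hWb)
        _ ≤ C₁ * P := mul_le_mul' (le_max_right _ _) le_rfl
  have hZ'10 : Z' 1 0 = ν * Y 1 0 := (conj_torus_unipotent_apply σ hJ ht hd n' Y hg').1
  have h3 := hsq hprod hZ10 hn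
  have h3' := hsq hprod' hZ'10 hn'
  -- `2ν y₁₀ (x − x') = (2Z₁₁ − τ) − (2Z'₁₁ − τ)`
  have hid : (x - x') * (2 * ν * Y 1 0) = (2 * Z 1 1 - Matrix.trace Y) + -(2 * Z' 1 1 - Matrix.trace Y) := by
    rw [hZ11, hZ'11]; ring
  have h4 : normAbs K (x - x') * (normAbs K 2 * φ ^ 2 * normAbs K (Y 1 0)) ≤ NNReal.sqrt (C₁ * P) := by
    have h5 : normAbs K ((x - x') * (2 * ν * Y 1 0)) ≤ NNReal.sqrt (C₁ * P) := by
      rw [hid]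
      refine (normAbs_add_le_max _ _).trans ?_
      rw [normAbs_neg]
      exact max_le h3 h3'
    rwa [map_mul, map_mul, map_mul, hνn] at h5
  -- multiply by `√β` and cancel one `φ`
  have h6 : normAbs K (x - x') * (normAbs K 2 * φ ^ 2 * normAbs K (Y 1 0)) * NNReal.sqrt β ≤ NNReal.sqrt (C₁ * R * normAbs K (Y 1 0)) * φ := by
    have h7 : NNReal.sqrt (C₁ * P) * NNReal.sqrt β = NNReal.sqrt (C₁ * R * normAbs K (Y 1 0)) * φ := by
      rw [← NNReal.sqrt_mul, hPdef, show C₁ * (R / β * φ ^ 2 * normAbs K (Y 1 0)) * β = (C₁ * R * normAbs K (Y 1 0)) * φ ^ 2 by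
        rw [div_eq_mul_inv]; field_simp, NNReal.sqrt_mul, NNReal.sqrt_sq]
    rw [← h7]
    exact mul_le_mul' h4 le_rfl
  have h8 : normAbs K (x - x') * (normAbs K 2 * φ * normAbs K (Y 1 0)) * NNReal.sqrt β * φ ≤ NNReal.sqrt (C₁ * R * normAbs K (Y 1 0)) * φ := by
    calc normAbs K (x - x') * (normAbs K 2 * φ * normAbs K (Y 1 0)) * NNReal.sqrt β * φ
        = normAbs K (x - x') * (normAbs K 2 * φ ^ 2 * normAbs K (Y 1 0)) * NNReal.sqrt β := by ring
      _ ≤ NNReal.sqrt (C₁ * R * normAbs K (Y 1 0)) * φ := h6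
  exact le_of_mul_le_mul_right h8 hφ0

end Fibre


end Summit.HodgeConjecture.HodgeConjecture.Cruxes.H413.K2E3HC14EllU11Fibre

end
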